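import Literature.NumberTheory.EllipticCurves.HeegnerPointsKolyvaginPrimaryCebotarevProofs
import Literature.NumberTheory.EllipticCurves.HeegnerPointsKolyvaginPrimaryLocalTrivialProofs
import Literature.NumberTheory.EllipticCurves.SelmerTorsionInclusion
import Literature.NumberTheory.EllipticCurves.KummerSelmerStructure
import Summits.BirchSwinnertonDyer.Rank1Residual.X11b.TorsionLevelCohomology
import HarnessLib

/-!
# Route `ErratumRoadFive`, crux `ShimuraKolyvaginOrderBoundInertFromFive` (item
# stmt-BirchSwinnertonDyer-19718) — the MACHINE half of the level shift, I: McCallum's Cor. 3.2 ONE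
# LEVEL DEEPER (Kolyvagin primes of depth `M + k` with prescribed local orders of LEVEL-`p^M` classes)

Cell `bsd-stepL`, seat `bsd-stepL-shim-p1` (prover g8), HELPER for the crux
`Summit.BirchSwinnertonDyer.BirchSwinnertonDyer.Theses.ErratumRoadFive.ShimuraKolyvaginOrderBoundInertFromFive`
(`--supports stmt-BirchSwinnertonDyer-19718 --as helper`; K2 route `route-BirchSwinnertonDyer-ErratumRoadFive`
rev 19; skeleton v2 df9d5864b1b31f6b, stub S1 `stub_inert_unitIndex`). Planner rulings g27 21:38Z ∕ g28
00:20:29Z: S1 ∕ S2 stay as typed and S1's road is the LEVEL SHIFT (referee g34 PASS on SHIM3A-MEMO-19616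
§1; McCallum 1991 Lemma 4.6, Kolyvagin Math. Ann. 291 §2, Howard 2004 Thm. 3.2.2): the Euler-system points
`P_m` are taken at Kolyvagin primes of depth `M + k` (`a_ℓ ≡ ℓ + 1 ≡ 0 mod p^{M+k}`), so that they are
invariant modulo `p^{M+k}`, while Kolyvagin's classes are kept at level `p^M`; then the bad-place Selmer
clause holds with NO Tamagawa clause (shim3a g2 p477215, the LOCAL lemma
`ShimuraKolyvaginLocalShift.kolyvaginClass_mem_selmerLocalKer_of_ringClassRational_shift`). What the
MACHINE (x11b3's `KolyvaginDescent.HypothesesM`) then needs is its Čebotarev field for the SMALLER set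
of primes: this file.

## What is proved (theorems only; no `def`, no named fact, no `sorry`)

* §1 `conjH1_torsionH1OfDvd`, `conjAct_torsionH1OfDvd` — the change of level
  `ι_* : H¹(K, E[d]) → H¹(K, E[n])` (`torsionH1OfDvd`, `d ∣ n`) commutes with the action of `Aut(K/ℚ)`.
* §2 `torsionH1OfDvd_pow_injective` — `ι_* : H¹(K, E[p^M]) → H¹(K, E[p^{M+k}])` is injective for `K`
  imaginary quadratic, `p` odd, `ρ̄_{E,p}` onto (`E(K)[p] = 0`; x11b3's `Levels.map_one_injective_of_forall_fixed_eq_zero`).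
* §3 `mem_torsionLocalKer_iff_torsionH1OfDvd_mem` — at a `K`-field `E` whose Galois group fixes
  `E(K̄)[n]`, `x_E = 0 ↔ (ι_* x)_E = 0` (`torsionLocalKer`).
* §4 **`McCallum1991_cor_3_2_pow_shift_of_chebotarev`** — McCallum 1991 Cor. 3.2 at level `p^M` with
  Kolyvagin primes of DEPTH `M + k`: for independent `τ`-eigenclasses `c_i ∈ H¹(K, E[p^M])` and
  `N_i ≤ ord`, above every bound a Kolyvagin prime `ℓ` with `Frob(ℓ) = Frob(∞)` on `E[p^{M+k}]` and
  `ord c_{i,λ} = p^{N_i}` exactly. DERIVED from x11b3's level-`p^{M+k}` theorem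
  (`McCallum1991_cor_3_2_pow_of_chebotarev`) applied to `ι_* c_i`, via §1–§3 and «`Γ_{K_λ}` fixes
  `E[p^{M+k}]` at a depth-`(M+k)` Kolyvagin prime of good reduction»
  (`absGaloisRestrict_smul_geomTorsion_eq_of_kolyvaginPrime`); good reduction at `λ` is forced by taking
  `ℓ` above the rational primes under the bad places of `E/K`. NO Galois-image input beyond what the
  level-`p^{M+k}` theorem already uses (`ρ̄_{E,p}` onto, on `E[p]` only): in particular
  `H¹(K(E[p^{M+k}])/K, E[p^M]) = 0` is NOT needed.

HONEST FRAMING: a TOOL for S1's level-shift road; S1 ∕ S2 and item 19718 stay OPEN; BSD is not proved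
by any of this; no census number moves. `p`-generic (`p` odd, `ρ̄` onto): serves 19899 ∕ KOLY verbatim.
[cite: McCallumLMS1991, §3 Prop. 3.1, Cor. 3.2; §4 Lemma 4.6] [cite: GrossLMS1991, §3 (3.1)–(3.2), §9]
[cite: Howard2004Duke, Thm. 3.2.2 (proof)] [cite: GreenbergLNM1716, §2 p. 63]
presearch: «Kolyvagin primes chosen at a deeper level p^{M+k} for level-p^M classes» → [corpus:
book:editornd-l-functions-arithmetic p0283 McCallum L4.6; paper:doi-10-1007-bf01445205 Kolyvagin MA291 §2
p0007–p0008; arxiv 1202.6342 Howard Thm 3.2.2] (SHIM3A-MEMO §1, referee g34) — the device is printed,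
this derivation (ι_* + the deeper Cor. 3.2) is ours; `lean search 'cor_3_2_pow_shift|torsionH1OfDvd_pow_injective'` → none.
-/

noncomputable section

open scoped Classical Pointwise

set_option linter.dupNamespace false

namespace Summit.BirchSwinnertonDyer.BirchSwinnertonDyer.Theorems

open WeierstrassCurve NumberField IsDedekindDomain Field
  Literature.NumberTheory.EllipticCurves Literature.NumberTheory.GaloisRepresentations
  Summit.BirchSwinnertonDyer.Rank1Residual

universe u

/-! ### §1 The change of level `ι_*` commutes with the action of `Aut(K/ℚ)` -/

section Conj

variable {K : Type u} [Field K] [CharZero K] (W : WeierstrassCurve ℚ)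
  {c : K ≃ₐ[ℚ] K} {τ : AlgebraicClosure K ≃+* AlgebraicClosure K}

/-- **`τ_* ∘ ι_* = ι_* ∘ τ_*`**: for a lift `τ` of `c ∈ Aut(K/ℚ)` and `d ∣ n`, the change of level
`ι_* : H¹(K, E[d]) → H¹(K, E[n])` (`torsionH1OfDvd`) commutes with the action `τ_*` on `H¹(K, E[·])`
(`IsLiftOfAut.conjH1`): both composites are the map of the compatible pair `(τ⁻¹ · τ, P ↦ τ P)` from
`E[d]` to `E[n]` (functoriality, `resH1Hom_comp`). Serre, *Galois Cohomology*, I.§2.4. [folklore] -/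
theorem conjH1_torsionH1OfDvd (hτ : IsLiftOfAut c τ) {d n : ℤ} (h : d ∣ n)
    (x : galH1Torsion (W.baseChange K) d) :
    hτ.conjH1 W n (torsionH1OfDvd (W.baseChange K) h x) =
      torsionH1OfDvd (W.baseChange K) h (hτ.conjH1 W d x) := by
  change (resH1Hom hτ.conjGalCMH (hτ.torsionMap W n) (hτ.torsionMap_smul W n)).comp
      (torsionH1OfDvd (W.baseChange K) h) x =
    (torsionH1OfDvd (W.baseChange K) h).comp
      (resH1Hom hτ.conjGalCMH (hτ.torsionMap W d) (hτ.torsionMap_smul W d)) x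
  unfold torsionH1OfDvd
  -- both composite pairs are `(τ⁻¹ · τ, P ↦ τ P) : E[d] → E[n]`
  rw [resH1Hom_comp, resH1Hom_comp]
  exact DFunLike.congr_fun (resH1Hom_congr (ContinuousMonoidHom.ext fun _ ↦ rfl)
    (AddMonoidHom.ext fun _ ↦ Subtype.ext rfl) _ _) x

/-- **`c_* ∘ ι_* = ι_* ∘ c_*`** for the canonical action `conjAct W c` of `c ∈ Aut(K/ℚ)` on
`H¹(K, E[·])`. [folklore] -/
theorem conjAct_torsionH1OfDvd (c : K ≃ₐ[ℚ] K) {d n : ℤ} (h : d ∣ n)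
    (x : galH1Torsion (W.baseChange K) d) :
    conjAct W c n (torsionH1OfDvd (W.baseChange K) h x) =
      torsionH1OfDvd (W.baseChange K) h (conjAct W c d x) :=
  conjH1_torsionH1OfDvd W (isLiftOfAut_liftAut c) h x

end Conj

/-! ### §2 `ι_* : H¹(K, E[p^M]) → H¹(K, E[p^{M+k}])` is injective (`E(K)[p] = 0`) -/

section Injective

variable {K : Type u} [Field K] [NumberField K] (W : WeierstrassCurve ℚ) [W.IsElliptic]

/-- `p^M ∣ p^{M+k}` in `ℤ`. [folklore] -/
theorem natCast_pow_dvd_natCast_pow_add (p M k : ℕ) :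
    ((p ^ M : ℕ) : ℤ) ∣ ((p ^ (M + k) : ℕ) : ℤ) :=
  Int.natCast_dvd_natCast.mpr (pow_dvd_pow p (Nat.le_add_right M k))

/-- **No `Γ_K`-fixed `p`-power torsion**: for `K` imaginary quadratic, `p` odd and `ρ̄_{E,p}` onto
(`E(K)[p] = 0`, tree `torsionBy_eq_bot_of_isImaginaryQuadratic`), a `Γ_K`-fixed point of
`E(K̄)[p^j]` is `0` (Galois descent `E(K̄)^{Γ_K} = E(K)`, then `p`-torsion-freeness of `E(K)`).
[cite: GrossLMS1991, Lemma 4.3] -/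
theorem geomTorsion_pow_eq_zero_of_fixed (hK : IsImaginaryQuadratic K) {p : ℕ} (hp : p.Prime)
    (hp2 : p ≠ 2) (hρ : W.HasSurjectiveModNGaloisRep p) (j : ℕ)
    (P : geomTorsion (W.baseChange K) ((p ^ j : ℕ) : ℤ))
    (hP : ∀ σ : absoluteGaloisGroup K, σ • P = P) : P = 0 := by
  haveI : (W.baseChange K).IsElliptic := inferInstanceAs (W.map (algebraMap ℚ K)).IsElliptic
  haveI : PerfectField K := PerfectField.ofCharZero
  have hbot := torsionBy_eq_bot_of_isImaginaryQuadratic W K hK hp hp2 hρ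
  have hA : ∀ a : (W.baseChange K).toAffine.Point, p • a = 0 → a = 0 := fun a ha ↦ by
    have : a ∈ AddSubgroup.torsionBy (W.baseChange K).toAffine.Point (p : ℤ) := by
      rw [mem_torsionBy_iff, natCast_zsmul]; exact ha
    rw [hbot] at this
    exact this
  have hpow : ∀ (j : ℕ) (R : (W.baseChange K).toAffine.Point), p ^ j • R = 0 → R = 0 := by
    intro j
    induction j with
    | zero => intro R h; simpa using h
    | succ j ih =>
      intro R h
      exact ih R (hA _ (by rw [← mul_nsmul, ← pow_succ]; exact h))
  have hfix : ∀ σ : absoluteGaloisGroup K, σ • (P : geomPoints (W.baseChange K)) = P :=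
    fun σ ↦ congrArg Subtype.val (hP σ)
  obtain ⟨R, hR⟩ := exists_toGeomPoints_eq_of_forall_smul_eq (W.baseChange K) hfix
  have hRj : p ^ j • R = 0 := by
    apply toGeomPoints_injective (W.baseChange K)
    rw [map_nsmul, hR, map_zero, ← natCast_zsmul]
    push_cast
    exact (mem_geomTorsion_iff _ _ _).mp P.2
  apply Subtype.ext
  rw [ZeroMemClass.coe_zero, ← hR, hpow j R hRj, map_zero]

/-- **`ι_* : H¹(K, E[p^M]) → H¹(K, E[p^{M+k}])` is injective** for `K` imaginary quadratic, `p`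
odd, `ρ̄_{E,p}` onto: the kernel is `E[p^{M+k}]^{Γ_K}/p^M` (Kummer), and `E[p^{M+k}]^{Γ_K} = 0`
(`geomTorsion_pow_eq_zero_of_fixed`); x11b3's `Levels.map_one_injective_of_forall_fixed_eq_zero`
through `map_torsionInclusion_one_apply`. [cite: GreenbergLNM1716, §2 p. 63] -/
theorem torsionH1OfDvd_pow_injective (hK : IsImaginaryQuadratic K) {p : ℕ} (hp : p.Prime)
    (hp2 : p ≠ 2) (hρ : W.HasSurjectiveModNGaloisRep p) (M k : ℕ) :
    Function.Injective
      (torsionH1OfDvd (W.baseChange K) (natCast_pow_dvd_natCast_pow_add p M k)) := by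
  haveI : (W.baseChange K).IsElliptic := inferInstanceAs (W.map (algebraMap ℚ K)).IsElliptic
  have key : Function.Injective
      (galoisCohomology.map ((W.baseChange K).torsionInclusion
        (natCast_pow_dvd_natCast_pow_add p M k)) 1) := by
    refine X11b.Levels.map_one_injective_of_forall_fixed_eq_zero (n := p ^ M) ?_ ?_ ?_ ?_
    · intro b hb
      have hb' : ((p ^ M : ℕ) : ℤ) • (b : geomPoints (W.baseChange K)) = 0 := by
        rw [natCast_zsmul, ← AddSubmonoidClass.coe_nsmul, hb, ZeroMemClass.coe_zero]
      exact ⟨⟨(b : geomPoints (W.baseChange K)), (mem_geomTorsion_iff _ _ _).2 hb'⟩,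
        Subtype.ext rfl⟩
    · intro a a' h
      exact Subtype.ext (congrArg
        (fun P : geomTorsion (W.baseChange K) ((p ^ (M + k) : ℕ) : ℤ) ↦
          (P : geomPoints (W.baseChange K))) h)
    · intro a
      apply Subtype.ext
      rw [AddSubmonoidClass.coe_nsmul, ZeroMemClass.coe_zero, ← natCast_zsmul]
      exact (mem_geomTorsion_iff _ _ _).1 a.2
    · intro b hb
      exact geomTorsion_pow_eq_zero_of_fixed W hK hp hp2 hρ (M + k) b fun σ ↦ by
        have h := hb σ
        rwa [torsionGaloisModule_apply_apply] at h
  intro x y hxy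
  apply key
  rw [map_torsionInclusion_one_apply, map_torsionInclusion_one_apply]
  exact hxy

end Injective

/-! ### §3 The local kernel at a place whose Galois group fixes `E[n]`: `x_E = 0 ↔ (ι_* x)_E = 0` -/

section Local

variable {K : Type u} [Field K] [CharZero K] (X : WeierstrassCurve K) [X.IsElliptic]
  (E : Type u) [Field E] [Algebra K E]

/-- **`x_E = 0` in `H¹(E, E[d])` iff `(ι_* x)_E = 0` in `H¹(E, E[n])`** (`d ∣ n`, `d ≠ 0`), at a
`K`-field `E` whose absolute Galois group FIXES `E(K̄)[n]` (printed: `λ` a Kolyvagin prime with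
`Frob(λ)` trivial on `E[p^{M+k}]`, "`E(K_λ)_{p^M} = E_{p^M}`", McCallum 1991 §4): both conditions say
that the chosen cocycle of `x` VANISHES on `Γ_E` (the only coboundary of a trivial module is `0`, and
`E(K̄)[d] → E(K̄_E)[d]`, `E[d] ↪ E[n]` are injective). [cite: McCallumLMS1991, §3 (3), §4]
[cite: GrossLMS1991, Prop. 9.6] -/
theorem mem_torsionLocalKer_iff_torsionH1OfDvd_mem {d n : ℕ} (hdn : d ∣ n) (hd : d ≠ 0)
    (hn : n ≠ 0)
    (htriv : ∀ (g : absoluteGaloisGroup E) (Q : geomTorsion X ((n : ℕ) : ℤ)),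
      resGal (K := K) E g • Q = Q)
    (x : galH1Torsion X ((d : ℕ) : ℤ)) :
    x ∈ X.torsionLocalKer E ((d : ℕ) : ℤ) ↔
      torsionH1OfDvd X (Int.natCast_dvd_natCast.mpr hdn) x ∈ X.torsionLocalKer E ((n : ℕ) : ℤ) := by
  have hle := X.geomTorsion_le_of_dvd (Int.natCast_dvd_natCast.mpr hdn)
  -- `Γ_E` fixes `E[d] ⊆ E[n]` too
  have htrivd : ∀ (g : absoluteGaloisGroup E) (Q : geomTorsion X ((d : ℕ) : ℤ)),
      resGal (K := K) E g • Q = Q := fun g Q ↦ by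
    have h := congrArg Subtype.val (htriv g ⟨(Q : geomPoints X), hle Q.2⟩)
    exact Subtype.ext h
  have hd' : ((d : ℕ) : ℤ) ≠ 0 := Int.natCast_ne_zero.mpr hd
  have hn' : ((n : ℕ) : ℤ) ≠ 0 := Int.natCast_ne_zero.mpr hn
  -- hence fixes the local torsion of both levels (surjectivity of `E(K̄)[m] → E(K̄_E)[m]`)
  have hfixd : ∀ (g : absoluteGaloisGroup E) (a : AddSubgroup.torsionBy (localPoints X E) ((d : ℕ) : ℤ)),
      g • a = a := fun g a ↦ by
    obtain ⟨Q, rfl⟩ := (torsionPointsMap_bijective_of_ne_zero X _ (E := E) hd').2 a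
    rw [← torsionPointsMap_smul, htrivd]
  have hfixn : ∀ (g : absoluteGaloisGroup E) (a : AddSubgroup.torsionBy (localPoints X E) ((n : ℕ) : ℤ)),
      g • a = a := fun g a ↦ by
    obtain ⟨Q, rfl⟩ := (torsionPointsMap_bijective_of_ne_zero X _ (E := E) hn').2 a
    rw [← torsionPointsMap_smul, htriv]
  obtain ⟨f, rfl⟩ := oneCocycleClass_surjective _ x
  -- `ι_* [f] = [ι ∘ f]`
  have hι : torsionH1OfDvd X (Int.natCast_dvd_natCast.mpr hdn) (oneCocycleClass _ f) =
      oneCocycleClass _ (contOneCocycles.pullback (ContinuousMonoidHom.id _)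
        (resHomOfEquivariant (ContinuousMonoidHom.id _) (AddSubgroup.inclusion hle) fun _ _ ↦ rfl) f) :=
    map_oneCocycleClass (X := discreteTopRep (absoluteGaloisGroup K) (geomTorsion X ((d : ℕ) : ℤ)))
      (Y := discreteTopRep (absoluteGaloisGroup K) (geomTorsion X ((n : ℕ) : ℤ))) _ _ f
  rw [hι]
  change oneCocycleClass _ f ∈ resKer _ _ _ ↔ oneCocycleClass _ _ ∈ resKer _ _ _
  rw [oneCocycleClass_mem_resKer_iff, oneCocycleClass_mem_resKer_iff]
  constructor
  · rintro ⟨a, ha⟩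
    refine ⟨0, fun g ↦ ?_⟩
    rw [smul_zero, sub_zero]
    have h0 : torsionPointsMap X E ((d : ℕ) : ℤ) (f.1 (resGal (K := K) E g)) = 0 := by
      rw [ha g, hfixd, sub_self]
    have hf0 : f.1 (resGal (K := K) E g) = 0 :=
      (torsionPointsMap_bijective_of_ne_zero X _ (E := E) hd').1 (by rw [h0, map_zero])
    change torsionPointsMap X E ((n : ℕ) : ℤ) (AddSubgroup.inclusion hle (f.1 (resGal (K := K) E g))) = 0
    rw [hf0, map_zero, map_zero]
  · rintro ⟨a, ha⟩
    refine ⟨0, fun g ↦ ?_⟩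
    rw [smul_zero, sub_zero]
    have h0 : torsionPointsMap X E ((n : ℕ) : ℤ)
        (AddSubgroup.inclusion hle (f.1 (resGal (K := K) E g))) = 0 := by
      have h := ha g
      rw [hfixn, sub_self] at h
      exact h
    have h1 : AddSubgroup.inclusion hle (f.1 (resGal (K := K) E g)) = 0 :=
      (torsionPointsMap_bijective_of_ne_zero X _ (E := E) hn').1 (by rw [h0, map_zero])
    have hf0 : f.1 (resGal (K := K) E g) = 0 := by
      have := congrArg Subtype.val h1
      exact Subtype.ext this
    rw [hf0, map_zero]

end Local

/-! ### §4 McCallum's Cor. 3.2 at level `p^M` with Kolyvagin primes of depth `M + k` -/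

section Main

variable {W : WeierstrassCurve ℚ} {K : Type u} [Field K] [NumberField K]

/-- **McCallum 1991, Cor. 3.2 ONE LEVEL DEEPER: Kolyvagin primes of depth `M + k` with prescribed
local orders of LEVEL-`p^M` classes.** Hypotheses exactly those of x11b3's
`McCallum1991_cor_3_2_pow_of_chebotarev` (the `cebotarev` field of `KolyvaginDescent.HypothesesM` at
level `p^M`): `K` imaginary quadratic with complex conjugation `c`; `p` odd with `ρ̄_{E,p}` onto and a
Weil pairing on `E[p]`; non-zero independent `τ`-eigenclasses `c_i ∈ H¹(K, E[p^M])`; `N_i` with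
`p^{N_i−1} c_i ≠ 0`; the Čebotarev density theorem. Conclusion: above every bound a Kolyvagin prime `ℓ`
(`IsKolyvaginPrime N W K p ℓ`) with **`Frob(ℓ) = Frob(∞)` in `Gal(K(E[p^{M+k}])/ℚ)`**
(`FrobEqFrobInfty W K (p^(M+k)) ℓ`, so `a_ℓ ≡ ℓ + 1 ≡ 0 mod p^{M+k}`) and `ord c_{i,λ} = p^{N_i}` at
`λ ∋ ℓ`. Proof: apply the level-`p^{M+k}` theorem to `ι_* c_i ∈ H¹(K, E[p^{M+k}])` — still non-zero,
independent, `τ`-eigen with the same orders (`ι_*` is injective, §2, and `Aut(K/ℚ)`-equivariant, §1) —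
with the bound raised above the rational primes under the bad places of `E/K`; at the resulting `λ`,
`E/K` has good reduction and `Γ_{K_λ}` fixes `E[p^{M+k}]`
(`absGaloisRestrict_smul_geomTorsion_eq_of_kolyvaginPrime`), so `(p^a c_i)_λ = 0 ↔ (p^a ι_* c_i)_λ = 0`
(§3). This is the Čebotarev input of the LEVEL-SHIFT road (McCallum L4.6 ∕ Howard Thm. 3.2.2: classes at
level `p^M`, primes in `S(M+k)`), obtained with NO new Galois-image hypothesis.
[cite: McCallumLMS1991, §3 Cor. 3.2 (with Prop. 3.1), §4 Lemma 4.6] [cite: Howard2004Duke, Thm. 3.2.2 (proof)]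
[cite: GrossLMS1991, §3 (3.2), §9] -/
theorem McCallum1991_cor_3_2_pow_shift_of_chebotarev
    (hC : Literature.NumberTheory.Automorphic.chebotarev_artinRep)
    {N : ℕ} [NeZero N] [W.IsElliptic] (hK : IsImaginaryQuadratic K) {p : ℕ} (hp : p.Prime)
    (hp2 : p ≠ 2) (hρ : W.HasSurjectiveModNGaloisRep p) (hW : W.exists_weilPairing p) {M : ℕ}
    (hM : 1 ≤ M) (k : ℕ) {c : K ≃ₐ[ℚ] K} (hc : c ≠ 1) {r : ℕ}
    (cs : Fin r → galH1Torsion (W.baseChange K) ((p ^ M : ℕ) : ℤ)) (h0 : ∀ i, cs i ≠ 0)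
    (Nv : Fin r → ℕ) (hN : ∀ i, Nv i ≠ 0 → ((p : ℤ) ^ (Nv i - 1)) • cs i ≠ 0)
    (hτ : ∀ i, ∃ e : ℤ, (e = 1 ∨ e = -1) ∧ conjAct W c ((p ^ M : ℕ) : ℤ) (cs i) = e • cs i)
    (hind : ∀ a : Fin r → ℤ, ∑ i, a i • cs i = 0 → ∀ i, a i • cs i = 0) (b : ℕ) :
    ∃ ℓ : ℕ, b < ℓ ∧ IsKolyvaginPrime N W K p ℓ ∧ FrobEqFrobInfty W K (p ^ (M + k)) ℓ ∧
      ∀ i, ∀ v : HeightOneSpectrum (𝓞 K), (ℓ : 𝓞 K) ∈ v.asIdeal →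
        (((p : ℤ) ^ Nv i) • cs i ∈
            (W.baseChange K).torsionLocalKer (v.adicCompletion K) ((p ^ M : ℕ) : ℤ) ∧
          (Nv i ≠ 0 → ((p : ℤ) ^ (Nv i - 1)) • cs i ∉
            (W.baseChange K).torsionLocalKer (v.adicCompletion K) ((p ^ M : ℕ) : ℤ))) := by
  classical
  haveI : (W.baseChange K).IsElliptic := inferInstanceAs (W.map (algebraMap ℚ K)).IsElliptic
  have hdvd := natCast_pow_dvd_natCast_pow_add p M k
  set ι := torsionH1OfDvd (W.baseChange K) hdvd with hιdef
  have hιinj : Function.Injective ι := torsionH1OfDvd_pow_injective W hK hp hp2 hρ M k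
  -- ### the shifted classes `ι_* c_i ∈ H¹(K, E[p^{M+k}])`
  set cs' : Fin r → galH1Torsion (W.baseChange K) ((p ^ (M + k) : ℕ) : ℤ) := fun i ↦ ι (cs i)
    with hcs'
  have h0' : ∀ i, cs' i ≠ 0 := fun i h ↦ h0 i (hιinj (by rw [map_zero]; exact h))
  have hN' : ∀ i, Nv i ≠ 0 → ((p : ℤ) ^ (Nv i - 1)) • cs' i ≠ 0 := fun i hi h ↦
    hN i hi (hιinj (by rw [map_zsmul, map_zero]; exact h))
  have hτ' : ∀ i, ∃ e : ℤ, (e = 1 ∨ e = -1) ∧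
      conjAct W c ((p ^ (M + k) : ℕ) : ℤ) (cs' i) = e • cs' i := fun i ↦ by
    obtain ⟨e, he, hec⟩ := hτ i
    exact ⟨e, he, by rw [hcs', conjAct_torsionH1OfDvd, hec, map_zsmul]⟩
  have hind' : ∀ a : Fin r → ℤ, ∑ i, a i • cs' i = 0 → ∀ i, a i • cs' i = 0 := by
    intro a ha i
    have hsum : ι (∑ j, a j • cs j) = 0 := by
      rw [map_sum]
      simpa only [map_zsmul] using ha
    have h := hind a (hιinj (by rw [hsum, map_zero])) i
    change a i • ι (cs i) = 0
    rw [← map_zsmul, h, map_zero]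
  -- ### the bound: above `b` and above the rational primes under the bad places of `E/K`
  have hbad : ((W.baseChange K).badPlaces (𝓞 K)).Finite := (W.baseChange K).finite_badPlaces_holds (𝓞 K)
  set B : ℕ := hbad.toFinset.sup fun w ↦ (Rat.HeightOneSpectrum.primesEquiv (w.under (𝓞 ℚ)) : ℕ)
    with hB
  have hM' : 1 ≤ M + k := le_trans hM (Nat.le_add_right M k)
  obtain ⟨ℓ, hbℓ, hKol, hfrob, hloc⟩ := McCallum1991_cor_3_2_pow_of_chebotarev (N := N) hC hK hp hp2
    hρ hW hM' hc cs' h0' Nv hN' hτ' hind' (max b B)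
  have hb : b < ℓ := lt_of_le_of_lt (le_max_left b B) hbℓ
  have hBℓ : B < ℓ := lt_of_le_of_lt (le_max_right b B) hbℓ
  -- ### good reduction at `λ`
  have hgood : hKol.place ∉ (W.baseChange K).badPlaces (𝓞 K) := by
    intro hmem
    have hle : (Rat.HeightOneSpectrum.primesEquiv (hKol.place.under (𝓞 ℚ)) : ℕ) ≤ B :=
      Finset.le_sup (f := fun w : HeightOneSpectrum (𝓞 K) ↦
        (Rat.HeightOneSpectrum.primesEquiv (w.under (𝓞 ℚ)) : ℕ)) (hbad.mem_toFinset.mpr hmem)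
    have hℓeq : (Rat.HeightOneSpectrum.primesEquiv (hKol.place.under (𝓞 ℚ)) : ℕ) = ℓ := by
      rw [(natCast_mem_asIdeal_iff_eq_primesEquiv_symm _ hKol.prime).mp hKol.natCast_mem_under,
        Equiv.apply_symm_apply]
    omega
  -- ### `Γ_{K_λ}` fixes `E[p^{M+k}]`
  haveI : NeZero (p ^ (M + k)) := ⟨pow_ne_zero _ hp.ne_zero⟩
  have hpv : ((p : ℕ) : 𝓞 K) ∉ hKol.place.asIdeal :=
    not_natCast_mem_of_prime_ne hKol.prime hp hKol.2.2.2.1 hKol.place hKol.mem_place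
  have hqv : ((((p ^ (M + k) : ℕ) : ℤ)) : 𝓞 K) ∉ hKol.place.asIdeal := by
    rw [Int.cast_natCast, Nat.cast_pow]
    exact fun h ↦ hpv (hKol.place.isPrime.mem_of_pow_mem (M + k) h)
  have htriv : ∀ (g : absoluteGaloisGroup (hKol.place.adicCompletion K))
      (Q : geomTorsion (W.baseChange K) ((p ^ (M + k) : ℕ) : ℤ)),
      resGal (K := K) (hKol.place.adicCompletion K) g • Q = Q := fun g Q ↦ by
    rw [resGal_eq_absGaloisRestrict]
    exact absGaloisRestrict_smul_geomTorsion_eq_of_kolyvaginPrime W hK hKol hfrob hgood hqv g Q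
  -- ### assemble
  refine ⟨ℓ, hb, hKol, hfrob, fun i v hv ↦ ?_⟩
  rw [hKol.mem_iff.mp hv]
  have key := hloc i hKol.place hKol.mem_place
  have hpd : p ^ M ∣ p ^ (M + k) := pow_dvd_pow p (Nat.le_add_right M k)
  have hpM : p ^ M ≠ 0 := pow_ne_zero M hp.ne_zero
  have hpMk : p ^ (M + k) ≠ 0 := pow_ne_zero _ hp.ne_zero
  have e1 := mem_torsionLocalKer_iff_torsionH1OfDvd_mem (W.baseChange K) (hKol.place.adicCompletion K)
    hpd hpM hpMk htriv (((p : ℤ) ^ Nv i) • cs i)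
  have e2 := mem_torsionLocalKer_iff_torsionH1OfDvd_mem (W.baseChange K) (hKol.place.adicCompletion K)
    hpd hpM hpMk htriv (((p : ℤ) ^ (Nv i - 1)) • cs i)
  rw [map_zsmul] at e1 e2
  exact ⟨e1.mpr key.1, fun hi h ↦ key.2 hi (e2.mp h)⟩

end Main

end Summit.BirchSwinnertonDyer.BirchSwinnertonDyer.Theorems

end
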